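import Summits.Langlands.Langlands.Statement
import Literature.NumberTheory.EllipticCurves.FramedTateGaloisRep
import Literature.NumberTheory.Automorphic.CaraianiNewtonResidualImageModularity
import Literature.NumberTheory.Automorphic.CaraianiNewtonResidualImageModularityProofs
import Literature.NumberTheory.Automorphic.ReciprocityGLnPotentialModularityTateProofs
import Literature.NumberTheory.Automorphic.GLnAdelicStructureProofs
import HarnessLib

/-!
# `Lines/QuarticCMEllipticGaloisToAutomorphic_special` — F3 floor witness for the rung (generation 15, dial θ18 =
# degree of the imaginary CM base field in Caraiani–Newton 2023, Cor. 6.1.1).  Sorry-free.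

* FAMILY `EllipticGaloisToAutomorphicCM d` and RUNG `QuarticCMEllipticGaloisToAutomorphic := family 4`, verbatim as in
  the skeleton `Lines/QuarticCMEllipticGaloisToAutomorphic.lean` and `_onpath.lean`.
* BRIDGE `of_weightZeroHecke`: weight-zero automorphy with Hecke polynomials `X² - a_w X + q_w` at the good places
  (the conclusion shape of the tree's Caraiani–Newton facts) ⇒ the family's conclusion for `ρ_{E,ℓ}^∨` with `m = 2`.
* FLOOR `d = 2`: `floor_two : CaraianiNewton2023_cor611_nonCM_printed → EllipticGaloisToAutomorphicCM 2`
  (Caraiani–Newton 2023, Cor. 6.1.1, the in-tree named fact, [cite: CaraianiNewton2023, Cor. 6.1.1]) and the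
  F3 `example`; `floor_hypotheses_iff`: at `d = 2` the side conditions "CM" and "`ζ₅ ∉ K`" are theorems, so the
  dial moves exactly one hypothesis (the degree).
-/

noncomputable section

set_option linter.dupNamespace false

open scoped MatrixGroups Matrix NumberField Classical Polynomial
open Filter IsDedekindDomain Field Polynomial WeierstrassCurve
open Literature.NumberTheory.Automorphic Literature.NumberTheory.GaloisRepresentations
open Literature.NumberTheory.EllipticCurves
open Literature.NumberTheory.PAdicHodge
open Summit.Langlands

namespace Summit.Langlands.Langlands.Cruxes.ReciprocityUpToIrreducibility.QuarticCMEllipticGaloisToAutomorphic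

/-- **The RUNG FAMILY, dial = degree `d` of the imaginary CM base field** (clause (B) of the summit at
`n = 2` on the Caraiani–Newton sector, Galois-side and archimedean-free exactly as the summit's
`Corresponds`): for every number field `K` which is CM (`NumberField.IsCMField`: a totally complex quadratic
extension of its maximal totally real subfield) of degree `d` in which every fifth root of unity is trivial,
every elliptic curve `E / K` WITHOUT complex multiplication whose mod-`3` representation is absolutely
irreducible over `K(ζ₃)` OR whose mod-`5` representation is absolutely irreducible over `K(ζ₅)`
(`ModPImageAbsIrreducibleOverCyclotomic`, every framing, every model), every prime `ℓ` and `ι : ℚ̄_ℓ ≃+* ℂ`: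
if the framed dual Tate module `ρ := ρ_{E,ℓ}^∨ : Γ_K → GL₂(ℚ̄_ℓ)` is irreducible and de Rham at the places
above `ℓ` (for the pinned Fontaine datum), then there are a cuspidal automorphic representation `π` of
`GL₂(𝔸_K)` and a shift `m : ℕ` such that at all but finitely many finite places `v`, `π_v` is unramified
with Satake parameter `α`, `ρ` is unramified at `v`, and every arithmetic Frobenius at `v` has characteristic
polynomial `∏_{a ∈ α} (X - ι⁻¹((q_v^{(m-1)/2} a)⁻¹))` on `ρ` (`arithFrobPolyOfSatake ι q_v m α`). -/
def EllipticGaloisToAutomorphicCM (d : ℕ) : Prop :=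
  ∀ (K : Type) [Field K] [NumberField K], NumberField.IsCMField K → Module.finrank ℚ K = d →
    (∀ x : K, x ^ 5 = 1 → x = 1) →
    ∀ (E : WeierstrassCurve K) [E.IsElliptic], ¬ E.HasCM →
      (ModPImageAbsIrreducibleOverCyclotomic E 3 ∨
        @ModPImageAbsIrreducibleOverCyclotomic K _ E 5 ⟨Nat.prime_five⟩) →
      ∀ (ℓ : ℕ) [Fact ℓ.Prime] (ι : PadicAlgCl ℓ ≃+* ℂ),
        (E.framedTateGaloisRepDual ℓ).toGaloisRep.IsIrreducible →
        (∀ (v : HeightOneSpectrum (𝓞 K)) (hv : ((ℓ : ℕ) : 𝓞 K) ∈ v.asIdeal),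
            (fontainePstAdicCompletion v ℓ hv).IsDeRhamFramed ((E.framedTateGaloisRepDual ℓ).toLocal v)) →
        ∃ (hK : isCompact_glFiniteIntegralLevel 2 K) (π : CuspidalAutomorphicRepData 2 K hK) (m : ℕ),
          ∀ᶠ v : HeightOneSpectrum (𝓞 K) in Filter.cofinite, ∃ α : Multiset ℂ,
            π.1.HasSatakeParamAt v α ∧
            (E.framedTateGaloisRepDual ℓ).IsUnramifiedAt v ∧
            (E.framedTateGaloisRepDual ℓ).HasFrobCharpolyAt v (arithFrobPolyOfSatake ι v.residueCard m α)

/-- **THE RUNG** (the filed statement): the family at `d = 4` — clause (B) for the Tate modules of non-CM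
elliptic curves with residually large image over imaginary CM QUARTIC fields `K ≠ ℚ(ζ₅)`. -/
def QuarticCMEllipticGaloisToAutomorphic : Prop := EllipticGaloisToAutomorphicCM 4
/-! ### The bridge: weight-zero automorphy with Hecke polynomials gives the family's conclusion (`m = 2`) -/

/-- **Normalisation identity** (verbatim from generation 6's `arithFrobPolyOfSatake_two_pair`). If
`q^{1/2}(z₁ + z₂) = a` and `q (z₁ z₂) = q ≠ 0`, then Buzzard–Gee's shifted arithmetic-Frobenius polynomial
with `m = 2` is `X² - (a/q) X + q⁻¹`. [folklore] -/
theorem arithFrobPolyOfSatake_two_pair {ℓ : ℕ} [Fact ℓ.Prime] (ι : PadicAlgCl ℓ ≃+* ℂ) (q : ℕ)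
    (a : ℤ) (z₁ z₂ : ℂ) (hq : q ≠ 0)
    (hsum : ((Real.sqrt q : ℝ) : ℂ) * ({z₁, z₂} : Multiset ℂ).sum = (a : ℂ))
    (hprod : ((Real.sqrt q : ℝ) : ℂ) ^ 2 * ({z₁, z₂} : Multiset ℂ).prod = (q : ℂ)) :
    arithFrobPolyOfSatake ι q 2 {z₁, z₂} =
      X ^ 2 - C ((a : PadicAlgCl ℓ) / (q : PadicAlgCl ℓ)) * X + C ((q : PadicAlgCl ℓ)⁻¹) := by
  have hs : ((Real.sqrt q : ℝ) : ℂ) * z₁ + ((Real.sqrt q : ℝ) : ℂ) * z₂ = a := by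
    simpa [Multiset.insert_eq_cons, mul_add] using hsum
  have hp' : ((Real.sqrt q : ℝ) : ℂ) ^ 2 * (z₁ * z₂) = q := by
    simpa [Multiset.insert_eq_cons] using hprod
  have hp : (((Real.sqrt q : ℝ) : ℂ) * z₁) * (((Real.sqrt q : ℝ) : ℂ) * z₂) = q := by
    linear_combination hp'
  have hq' : (q : ℂ) ≠ 0 := by exact_mod_cast hq
  have h1 : ((Real.sqrt q : ℝ) : ℂ) * z₁ ≠ 0 := fun h => hq' (by rw [← hp, h, zero_mul])
  have h2 : ((Real.sqrt q : ℝ) : ℂ) * z₂ ≠ 0 := fun h => hq' (by rw [← hp, h, mul_zero])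
  have hinv_sum : (((Real.sqrt q : ℝ) : ℂ) * z₁)⁻¹ + (((Real.sqrt q : ℝ) : ℂ) * z₂)⁻¹ = (a : ℂ) / q := by
    rw [inv_add_inv h1 h2, hs, hp]
  have hinv_prod : (((Real.sqrt q : ℝ) : ℂ) * z₁)⁻¹ * (((Real.sqrt q : ℝ) : ℂ) * z₂)⁻¹ = ((q : ℂ))⁻¹ := by
    rw [← mul_inv, hp]
  unfold arithFrobPolyOfSatake
  simp only [Multiset.insert_eq_cons, Multiset.map_cons, Multiset.map_singleton, Multiset.prod_cons,
    Multiset.prod_singleton, Nat.reduceSub, pow_one]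
  rw [X_sub_C_mul_X_sub_C, ← map_add ι.symm, ← map_mul ι.symm, hinv_sum, hinv_prod, map_div₀,
    map_inv₀, map_intCast, map_natCast]

/-- **THE BRIDGE.** The conclusion of Caraiani–Newton's facts for a curve `E / K` over the field — a
cuspidal `π` of weight zero with Hecke polynomial `X² - a_w(E) X + q_w` at every place of good reduction —
implies the family's conclusion for `ρ_{E,ℓ}^∨` with the same `π` and shift `m = 2`, at the cofinitely many
places of good reduction not above `ℓ` (`eventually_hasGoodReductionAt`, Silverman VIII.1.3): there `V_ℓ E`
is unramified with arithmetic-Frobenius polynomial `X² - a_w X + q_w` (Silverman C.21 Rem. 21.3, proved in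
the tree), hence `ρ_{E,ℓ}^∨` has `X² - (a_w/q_w) X + q_w⁻¹`, which is `arithFrobPolyOfSatake ι q_w 2 α` for the
Satake parameter `α` read off the Hecke polynomial. [folklore] -/
theorem of_weightZeroHecke {K : Type} [Field K] [NumberField K] {E : WeierstrassCurve K} [E.IsElliptic]
    (hE : ∃ (hK : isCompact_glFiniteIntegralLevel 2 K) (π : CuspidalAutomorphicRepData 2 K hK),
      π.1.HasWeightZero ∧
        ∀ w : HeightOneSpectrum (𝓞 K), E.HasGoodReductionAt w →
          π.1.HasHeckePolynomialAt w
            ((frobPoly (E.frobeniusTraceAt w) w.residueCard).map (Int.castRingHom ℂ)))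
    (ℓ : ℕ) [Fact ℓ.Prime] (ι : PadicAlgCl ℓ ≃+* ℂ) :
    ∃ (hK : isCompact_glFiniteIntegralLevel 2 K) (π : CuspidalAutomorphicRepData 2 K hK) (m : ℕ),
      ∀ᶠ v : HeightOneSpectrum (𝓞 K) in Filter.cofinite, ∃ α : Multiset ℂ,
        π.1.HasSatakeParamAt v α ∧
        (E.framedTateGaloisRepDual ℓ).IsUnramifiedAt v ∧
        (E.framedTateGaloisRepDual ℓ).HasFrobCharpolyAt v (arithFrobPolyOfSatake ι v.residueCard m α) := by
  obtain ⟨hK, π, -, hH⟩ := hE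
  refine ⟨hK, π, 2, ?_⟩
  have hc : Continuous fun x : Field.absoluteGaloisGroup K × E.rationalTateModule ℓ =>
      Literature.NumberTheory.EllipticCurves.rationalTateRepresentation (Field.absoluteGaloisGroup K)
        (WeierstrassCurve.geomPoints E) ℓ x.1 x.2 :=
    E.continuous_rationalGaloisRepTate_holds ℓ
  haveI hfin : Module.Finite ℚ_[ℓ] (E.rationalTateModule ℓ) := E.module_finite_rationalTateModule_holds ℓ
  filter_upwards [E.eventually_hasGoodReductionAt,
    eventually_natCast_not_mem_asIdeal K (Fact.out : ℓ.Prime).ne_zero] with v hgood hvℓ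
  obtain ⟨α, hα, hsum, hprod⟩ := exists_hasSatakeParamAt_of_hasHeckePolynomialAt_frobPoly (hH v hgood)
  have hF := hasFrobCharpolyAt_rationalTateGaloisRepOf_of_hasGoodReductionAt
    (E.trace_galoisRepTate_frobenius_of_hasGoodReductionAt_holds ℓ)
    (E.det_galoisRepTate_frobenius_of_hasGoodReductionAt_holds ℓ) hc hvℓ hgood
  rw [natCard_residueField_eq_residueCard] at hF
  have hD := E.hasFrobCharpolyAt_framedTateGaloisRepDual ℓ hc hF
  simp only [map_intCast, map_natCast] at hD
  refine ⟨α, hα, E.isUnramifiedAt_framedTateGaloisRepDual ℓ hgood hvℓ, ?_⟩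
  obtain ⟨z₁, z₂, rfl⟩ := Multiset.card_eq_two.1 hα.card_eq
  rw [arithFrobPolyOfSatake_two_pair ι v.residueCard (E.frobeniusTraceAt v) z₁ z₂
    (by have := v.one_lt_residueCard; omega) hsum hprod]
  exact hD

/-! ### The floor: the family at `d = 2` is Caraiani–Newton Cor. 6.1.1 -/

/-- **Floor `d = 2` = THE F3 WITNESS** (Caraiani–Newton 2023, Cor. 6.1.1 as printed, the tree's named fact
`CaraianiNewton2023_cor611_nonCM_printed`): a CM field of degree `2` is an imaginary quadratic field
(totally complex, `NumberField.IsCMField.to_isTotallyComplex`), and the fact's conclusion feeds the bridge.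
[cite: CaraianiNewton2023, Cor. 6.1.1] -/
theorem floor_two (h : CaraianiNewton2023_cor611_nonCM_printed) : EllipticGaloisToAutomorphicCM 2 := by
  intro K _ _ hCM hd _h5 E _ hnCM himg ℓ _ ι _ _
  haveI := hCM
  exact of_weightZeroHecke (h K (NumberField.IsCMField.isTotallyComplex K) hd E hnCM himg) ℓ ι

/-- F3 in the brief's literal shape: `example : RungFamily θ₀` from the floor. -/
example (h : CaraianiNewton2023_cor611_nonCM_printed) : EllipticGaloisToAutomorphicCM 2 := floor_two h

/-- **The floor's hypotheses ARE the family's at `d = 2`**: an imaginary quadratic field is CM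
(`isCMField_of_isTotallyComplex_of_finrank_eq_two`) and contains no primitive fifth root of unity
(`eq_one_of_pow_five_eq_one_of_finrank_eq_two`) — so the dial moves exactly ONE hypothesis, the degree. -/
theorem floor_hypotheses_iff (K : Type) [Field K] [NumberField K] :
    (NumberField.IsTotallyComplex K ∧ Module.finrank ℚ K = 2) ↔
      (NumberField.IsCMField K ∧ Module.finrank ℚ K = 2 ∧ ∀ x : K, x ^ 5 = 1 → x = 1) := by
  constructor
  · rintro ⟨hK, hd⟩
    exact ⟨isCMField_of_isTotallyComplex_of_finrank_eq_two K hK hd, hd,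
      fun x hx => eq_one_of_pow_five_eq_one_of_finrank_eq_two hd hx⟩
  · rintro ⟨hCM, hd, -⟩
    haveI := hCM
    exact ⟨NumberField.IsCMField.isTotallyComplex K, hd⟩

/-! ### The line's own ladder at `d = 2` is a THEOREM of the tree (witness for the open core)

The open core of the rung (`Lemma622QuarticCM*` in the skeleton: "over an imaginary CM quartic field, `E[p]`
absolutely irreducible over `F(ζ_p)` ⇒ decomposed generic", `p ∈ {3,5}`) is Caraiani–Newton's Lemma 6.2.2 one degree
up.  At `d = 2` that lemma is PROVED in the tree, for every odd `p` and every continuous `ρ̄` — Chebotarev through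
`chebotarev_artinRep_holds`, the group theory through `CaraianiNewton.exists_disc_ne_zero_and_disc_apply_ne_zero`
(file `GaloisRepresentations/DecomposedGenericOfQuadratic`); consequently the floor fact itself is "Thm. 6.1 away"
(`CaraianiNewton2023_cor611_nonCM_printed_of_thm61`).  So the stub-level ladder is: d = 2 decided (below, no
hypothesis), d = 4 open (the stubs). [cite: CaraianiNewton2023, Lemma 6.2.2 p. 90] -/
example : ∀ (F : Type) [Field F] [NumberField F], Module.finrank ℚ F = 2 →
    ∀ (p : ℕ) [Fact p.Prime], p ≠ 2 → ∀ ρ : ModPGaloisRep F (ZMod p) 2,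
      (∀ (L : Type) [Field L] [Algebra F L] [IsCyclotomicExtension {p} F L],
        FramedRep.IsAbsolutelyIrreducible (FramedGaloisRep.restrictField L ρ)) →
      IsDecomposedGeneric (ρ : absoluteGaloisGroup F →* GL (Fin 2) (ZMod p)) :=
  CaraianiNewton2023_lemma622

end Summit.Langlands.Langlands.Cruxes.ReciprocityUpToIrreducibility.QuarticCMEllipticGaloisToAutomorphic

end
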